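import Literature.MathematicalPhysics.QuantumLattice.StabilitySmoothingTailsProofs
import Literature.MathematicalPhysics.QuantumLattice.StabilityTwirlPiecesProofs
import Literature.MathematicalPhysics.QuantumLattice.HastingsGeneratorProofs
import HarnessLib

/-!
# Continuous families of ball pieces; weighted local norms of grouped interactions

Top-down layer (seat B) of the formalisation of the Michalakis–Zwolak stability theorem
(hubbard.S19, `Literature.MathematicalPhysics.QuantumLattice.michalakis_zwolak`): bookkeeping
for writing the generator `D(t) = Σ_{Z'} ε 𝓕_W^t(V Z')` of Hastings' flow as a quasi-local
interaction family `Ψ_t` (MZ13 §5.2, "`D(s) = Σ_{Z ⊂ Λ} Φ'_Λ(Z, s)`", arXiv:1109.1588 p. 12), in the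
format of the flow Lieb–Robinson bounds (`norm_comm_flow_le_pow`):

* `exists_ball_pieces_family` — the telescoping twirl decomposition of a CONTINUOUS family
  `t ↦ F t` of Hermitian observables into pieces `P k t ∈ 𝔄_{b_x(r+k)}`, `k ≤ L`, continuous in
  `t`, with the base/step norm bounds of `exists_ball_pieces_of_twirl_errors`, and its
  quantitative form `exists_ball_pieces_family_of_pow_tails`;
* `torusDiam_cellBall_le` — balls of radius `i` have diameter `≤ 2i`;
* `sum_card_mul_norm_reindex_le` — the size-weighted local norm of a grouped interaction
  `Z ↦ Σ_{S i = Z} P i` is at most `Σ_{i : y ∈ S i} |S i| ‖P i‖`.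

No definitions, no named facts (theorems only).
-/

noncomputable section

open Matrix Complex MeasureTheory Finset
open scoped Matrix.Norms.L2Operator

namespace Literature.MathematicalPhysics.QuantumLattice

open Literature.Probability.LatticeModels

/-! ### Weighted local norm of a grouped interaction -/

section Reindex

variable {Λ : Type*} [Fintype Λ] [DecidableEq Λ] {q : ℕ} {ι : Type*} [Fintype ι]

/-- **Size-weighted local norm of the grouped interaction**:
`Σ_{Z ∋ x} |Z| ‖Σ_{S i = Z} P i‖ ≤ Σ_{i : x ∈ S i} |S i| ‖P i‖`. [folklore] -/
theorem sum_card_mul_norm_reindex_le (S : ι → Finset Λ) (P : ι → Op Λ q) (x : Λ) :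
    ∑ Z ∈ univ.filter (fun Z : Finset Λ => x ∈ Z),
        (#Z : ℝ) * ‖∑ i ∈ univ.filter (fun i => S i = Z), P i‖ ≤
      ∑ i ∈ univ.filter (fun i => x ∈ S i), (#(S i) : ℝ) * ‖P i‖ := by
  calc ∑ Z ∈ univ.filter (fun Z : Finset Λ => x ∈ Z),
        (#Z : ℝ) * ‖∑ i ∈ univ.filter (fun i => S i = Z), P i‖
      ≤ ∑ Z ∈ univ.filter (fun Z : Finset Λ => x ∈ Z),
          ∑ i ∈ univ.filter (fun i => S i = Z), (#(S i) : ℝ) * ‖P i‖ := by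
        refine sum_le_sum fun Z _ => ?_
        calc (#Z : ℝ) * ‖∑ i ∈ univ.filter (fun i => S i = Z), P i‖
            ≤ (#Z : ℝ) * ∑ i ∈ univ.filter (fun i => S i = Z), ‖P i‖ :=
              mul_le_mul_of_nonneg_left (norm_sum_le _ _) (by positivity)
          _ = ∑ i ∈ univ.filter (fun i => S i = Z), (#Z : ℝ) * ‖P i‖ := by rw [mul_sum]
          _ = ∑ i ∈ univ.filter (fun i => S i = Z), (#(S i) : ℝ) * ‖P i‖ := by
              refine sum_congr rfl fun i hi => ?_
              simp only [mem_filter, mem_univ, true_and] at hi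
              rw [hi]
    _ = ∑ i ∈ univ.filter (fun i => x ∈ S i), (#(S i) : ℝ) * ‖P i‖ := by
        rw [← sum_fiberwise_of_maps_to (g := S) (s := univ.filter (fun i => x ∈ S i))
          (t := univ.filter (fun Z : Finset Λ => x ∈ Z)) (fun i hi => by
            simp only [mem_filter, mem_univ, true_and] at hi ⊢; exact hi)]
        refine sum_congr rfl fun Z hZ => sum_congr ?_ fun _ _ => rfl
        ext i
        simp only [mem_filter, mem_univ, true_and]
        simp only [mem_filter, mem_univ, true_and] at hZ
        constructor
        · intro h; exact ⟨by rw [h]; exact hZ, h⟩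
        · intro h; exact h.2

end Reindex

/-! ### Geometry: the diameter of a ball -/

section Geometry

variable {d L : ℕ} [NeZero L] {κ : Type*} [Fintype κ] {q : ℕ}

/-- **A ball of radius `i` has diameter at most `2i`.** [folklore] -/
theorem torusDiam_cellBall_le (u : TorusSite d L) (i : ℕ) :
    torusDiam (cellBall u i : Finset (TorusSite d L × κ)) ≤ 2 * i := by
  refine Finset.sup_le fun a ha => Finset.sup_le fun b hb => ?_
  have ha' := mem_cellBall_iff.1 ha
  have hb' := mem_cellBall_iff.1 hb
  calc torusDist a.1 b.1 ≤ torusDist a.1 u + torusDist u b.1 := torusDist_triangle_holds a.1 u b.1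
    _ = torusDist u a.1 + torusDist u b.1 := by rw [torusDist_comm_holds a.1 u]
    _ ≤ i + i := add_le_add ha' hb'
    _ = 2 * i := by ring

end Geometry

/-! ### Continuous families of ball pieces -/

section Family

variable {d L : ℕ} [NeZero L] {κ : Type*} [Fintype κ] [DecidableEq κ] {q : ℕ}

/-- The twirl is a continuous (linear) map. [folklore] -/
theorem continuous_twirl {Λ : Type*} [Fintype Λ] [DecidableEq Λ] {q : ℕ} (S : Finset Λ) :
    Continuous fun M : Op Λ q => twirl S M := by
  let Lmap : Op Λ q →ₗ[ℂ] Op Λ q :=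
    { toFun := fun N => twirl S N, map_add' := twirl_add S, map_smul' := fun c N => twirl_smul S c N }
  exact (LinearMap.toContinuousLinearMap Lmap).continuous

/-- The twirl of `0` is `0`. [folklore] -/
theorem twirl_zero {Λ : Type*} [Fintype Λ] [DecidableEq Λ] {q : ℕ} (S : Finset Λ) :
    twirl S (0 : Op Λ q) = 0 := by
  have h := twirl_smul S (0 : ℂ) (0 : Op Λ q)
  rwa [zero_smul, zero_smul] at h

/-- **Telescoping ball pieces of a continuous family of Hermitian observables.** For
`F : ℝ → 𝔄` continuous with `F t` Hermitian, a centre `x` and a base radius `r`, there are pieces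
`P k t` (`k ≤ L`) with `Σ_{k ≤ L} P k t = F t`, `P k t` Hermitian and supported in
`cellBall x (r + k)`, each `P k` continuous, `‖P 0 t‖ ≤ ‖F t‖`,
`‖P (k+1) t‖ ≤ ‖F t − 𝔼_{b_x(r+k+1)ᶜ}(F t)‖ + ‖F t − 𝔼_{b_x(r+k)ᶜ}(F t)‖`, and `P k t = 0`
whenever `F t = 0` (the `Δ`-decomposition of BMNS/MZ13 Lemma 1 (iv), `T_{r+k} − T_{r+k−1}` with
`T_j = 𝔼_{b_x(j)ᶜ}(F t)`, `T_{r+L} = F t`). [cite: MichalakisZwolakCMP2013, §5.1 Lemma 1 (iv) (arXiv:1109.1588 pp. 9–10)] -/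
theorem exists_ball_pieces_family (x : TorusSite d L) (r : ℕ)
    {F : ℝ → Op (TorusSite d L × κ) q} (hF : ∀ t, (F t).IsHermitian) (hFc : Continuous F) :
    ∃ P : ℕ → ℝ → Op (TorusSite d L × κ) q,
      (∀ t, ∑ k ∈ range (L + 1), P k t = F t) ∧
      (∀ k t, (P k t).IsHermitian) ∧
      (∀ k t, IsSupportedOn (P k t) (cellBall x (r + k))) ∧
      (∀ k, Continuous (P k)) ∧
      (∀ t, ‖P 0 t‖ ≤ ‖F t‖) ∧
      (∀ k t, ‖P (k + 1) t‖ ≤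
        ‖F t - twirl (cellBall x (r + k + 1) : Finset (TorusSite d L × κ))ᶜ (F t)‖ +
        ‖F t - twirl (cellBall x (r + k) : Finset (TorusSite d L × κ))ᶜ (F t)‖) ∧
      (∀ t, F t = 0 → ∀ k, P k t = 0) := by
  classical
  set T : ℕ → ℝ → Op (TorusSite d L × κ) q :=
    fun j t => twirl (cellBall x j : Finset (TorusSite d L × κ))ᶜ (F t) with hTdef
  set P : ℕ → ℝ → Op (TorusSite d L × κ) q :=
    fun k t => if k = 0 then T r t else T (r + k) t - T (r + k - 1) t with hPdef
  have hP0 : ∀ t, P 0 t = T r t := fun t => by simp [hPdef]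
  have hPs : ∀ k t, P (k + 1) t = T (r + k + 1) t - T (r + k) t := fun k t => by
    simp only [hPdef, Nat.succ_ne_zero, if_false, Nat.add_succ_sub_one, add_assoc]
  have hTc : ∀ j, Continuous (T j) := fun j => (continuous_twirl _).comp hFc
  have hTL : ∀ t, T (r + L) t = F t := fun t => by
    simp only [hTdef, cellBall_eq_univ_of_half_le x ((Nat.div_le_self L 2).trans (Nat.le_add_left L r)),
      compl_univ, twirl_empty]
  refine ⟨P, fun t => ?_, fun k t => ?_, fun k t => ?_, fun k => ?_, fun t => ?_, fun k t => ?_,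
    fun t ht k => ?_⟩
  · -- telescoping
    rw [Finset.sum_range_succ', hP0]
    simp only [hPs]
    have h := Finset.sum_range_sub (fun k => T (r + k) t) L
    simp only [add_zero] at h
    rw [show (∑ i ∈ range L, (T (r + i + 1) t - T (r + i) t)) = T (r + L) t - T r t from h,
      sub_add_cancel, hTL]
  · rcases k with _ | k
    · rw [hP0]; exact isHermitian_twirl _ (hF t)
    · rw [hPs]; exact (isHermitian_twirl _ (hF t)).sub (isHermitian_twirl _ (hF t))
  · rcases k with _ | k
    · rw [hP0, add_zero]; exact isSupportedOn_twirl_compl _ (F t)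
    · rw [hPs, ← add_assoc]
      exact isSupportedOn_twirl_compl_sub (cellBall_mono x (Nat.le_succ _)) (F t)
  · rcases k with _ | k
    · have e : P 0 = T r := funext hP0
      rw [e]; exact hTc r
    · have e : P (k + 1) = fun t => T (r + k + 1) t - T (r + k) t := funext (hPs k)
      rw [e]; exact (hTc _).sub (hTc _)
  · rw [hP0]; exact norm_twirl_le _ (F t)
  · rw [hPs]
    exact norm_twirl_sub_twirl_le _ _ (F t)
  · rcases k with _ | k
    · rw [hP0]; simp only [hTdef, ht, twirl_zero]
    · rw [hPs]; simp only [hTdef, ht, twirl_zero, sub_self]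

/-- **Ball pieces of a continuous family with power-law envelopes.** If moreover, for `t` in a
set `S`, `‖F t‖ ≤ a C₀` and `‖F t − 𝔼_{b_x(r+k)ᶜ}(F t)‖ ≤ a C_p/(k+1)^p` for all `k`, `p`
(`a ≥ 0`, `C_p ≥ 0`), then the pieces satisfy `‖P k t‖ ≤ a (C₀ + 2 C_p 2^p)/(k+1)^p` for `t ∈ S`
and all `k`, `p`. [cite: MichalakisZwolakCMP2013, §5.1 Lemma 1 (iv) (arXiv:1109.1588 pp. 9–10)] -/
theorem exists_ball_pieces_family_of_pow_tails (x : TorusSite d L) (r : ℕ)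
    {F : ℝ → Op (TorusSite d L × κ) q} (hF : ∀ t, (F t).IsHermitian) (hFc : Continuous F)
    {S : Set ℝ} {a : ℝ} (ha : 0 ≤ a) {C : ℕ → ℝ} (hC : ∀ p, 0 ≤ C p)
    (hF0 : ∀ t ∈ S, ‖F t‖ ≤ a * C 0)
    (htail : ∀ t ∈ S, ∀ k p : ℕ,
      ‖F t - twirl (cellBall x (r + k) : Finset (TorusSite d L × κ))ᶜ (F t)‖ ≤
        a * (C p / ((k : ℝ) + 1) ^ p)) :
    ∃ P : ℕ → ℝ → Op (TorusSite d L × κ) q,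
      (∀ t, ∑ k ∈ range (L + 1), P k t = F t) ∧
      (∀ k t, (P k t).IsHermitian) ∧
      (∀ k t, IsSupportedOn (P k t) (cellBall x (r + k))) ∧
      (∀ k, Continuous (P k)) ∧
      (∀ t, F t = 0 → ∀ k, P k t = 0) ∧
      (∀ t ∈ S, ∀ k p : ℕ, ‖P k t‖ ≤ a * ((C 0 + 2 * C p * 2 ^ p) / ((k : ℝ) + 1) ^ p)) := by
  obtain ⟨P, hsum, hh, hs, hc, hbase, hstep, hzero⟩ := exists_ball_pieces_family x r hF hFc
  refine ⟨P, hsum, hh, hs, hc, hzero, fun t ht k p => ?_⟩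
  have hCp := hC p
  have hC0 := hC 0
  rcases k with _ | k
  · -- the base piece
    calc ‖P 0 t‖ ≤ ‖F t‖ := hbase t
      _ ≤ a * C 0 := hF0 t ht
      _ ≤ a * ((C 0 + 2 * C p * 2 ^ p) / (((0 : ℕ) : ℝ) + 1) ^ p) := by
          refine mul_le_mul_of_nonneg_left ?_ ha
          simp only [Nat.cast_zero, zero_add, one_pow, div_one]
          have : 0 ≤ 2 * C p * 2 ^ p := by positivity
          linarith
  · -- the telescoping pieces
    have hk1 : (0 : ℝ) < (k : ℝ) + 1 := by positivity
    have hk2 : (0 : ℝ) < ((k + 1 : ℕ) : ℝ) + 1 := by positivity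
    have e1 := htail t ht (k + 1) p
    have e0 := htail t ht k p
    have h2 : ‖P (k + 1) t‖ ≤ 2 * (a * (C p / ((k : ℝ) + 1) ^ p)) := by
      refine (hstep k t).trans ?_
      have hmono : a * (C p / (((k + 1 : ℕ) : ℝ) + 1) ^ p) ≤ a * (C p / ((k : ℝ) + 1) ^ p) :=
        mul_le_mul_of_nonneg_left (div_le_div_of_nonneg_left hCp (pow_pos hk1 p)
          (pow_le_pow_left₀ hk1.le (by push_cast; linarith) p)) ha
      have e1' : ‖F t - twirl (cellBall x (r + k + 1) : Finset (TorusSite d L × κ))ᶜ (F t)‖ ≤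
          a * (C p / (((k + 1 : ℕ) : ℝ) + 1) ^ p) := by rw [add_assoc]; exact e1
      linarith [e1'.trans hmono]
    refine h2.trans ?_
    -- `2 a C_p/(k+1)^p ≤ a (2 C_p 2^p)/(k+2)^p ≤ a (C₀ + 2 C_p 2^p)/(k+2)^p`
    have hpow : (((k + 1 : ℕ) : ℝ) + 1) ^ p ≤ (2 : ℝ) ^ p * ((k : ℝ) + 1) ^ p := by
      rw [← mul_pow]; refine pow_le_pow_left₀ hk2.le ?_ p; push_cast; linarith
    have h3 : C p / ((k : ℝ) + 1) ^ p ≤ C p * 2 ^ p / (((k + 1 : ℕ) : ℝ) + 1) ^ p := by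
      rw [div_le_div_iff₀ (pow_pos hk1 p) (pow_pos hk2 p)]
      calc C p * ((((k + 1 : ℕ) : ℝ)) + 1) ^ p ≤ C p * ((2 : ℝ) ^ p * ((k : ℝ) + 1) ^ p) :=
            mul_le_mul_of_nonneg_left hpow hCp
        _ = C p * 2 ^ p * ((k : ℝ) + 1) ^ p := by ring
    calc 2 * (a * (C p / ((k : ℝ) + 1) ^ p))
        ≤ 2 * (a * (C p * 2 ^ p / (((k + 1 : ℕ) : ℝ) + 1) ^ p)) := by gcongr
      _ = a * ((2 * C p * 2 ^ p) / (((k + 1 : ℕ) : ℝ) + 1) ^ p) := by ring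
      _ ≤ a * ((C 0 + 2 * C p * 2 ^ p) / (((k + 1 : ℕ) : ℝ) + 1) ^ p) :=
          mul_le_mul_of_nonneg_left (div_le_div_of_nonneg_right (by linarith) (by positivity)) ha

end Family

end Literature.MathematicalPhysics.QuantumLattice
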